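import Summits.PneNP.PneNP.Theorems.ORIncompressibilityNoMonotoneCompressionClique
import Summits.PneNP.PneNP.Theorems.ORIncompressibilityNoNegLimitedCompressionCliqueFreeze

/-!
# Route ORIncompressibility — `NoNegLimitedCompressionClique` (stmt-PneNP-13976)

Negation-limited OR-incompressibility of CLIQUE tuples: for every constant NOT budget `β` and
exponent `k`, for large `v` and `m·v² ≤ t ≤ v^k` (`t > 0`), no family of `m` De Morgan circuits
(`{∧₂, ∨₂, ¬}`), each with `negationCount ≤ β` and `size ≤ (t·v)^k`, has fibres pure for
`[∃ i, block i has a ⌊√v⌋-clique]`.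

## Proof: frozen NOT gates, then the monotone theorem as a black box

Fix one output circuit `C` with NOT gates `ν₁, …, ν_b` (`b ≤ β`) in program order; the RANK of
a NOT gate is the number of NOT gates before it. For a context `c : Fin β → Bool` the FROZEN
PROGRAM `C[c]` replaces the NOT gate of rank `ℓ` by the constant gate `c ℓ`; it is a program over
`{∧₂, ∨₂, 0, 1}`, so each of its wires carries a MONOTONE function of the input. The frozen family
of `C` consists of the wires of the `C[c]` feeding the NOT gates, and the output wire, for all
`2^β` contexts: `≤ 2^β (β + 1)` monotone functions, each computed (after constant elimination,
`GateList.const_or_exists_monotone_circuit`) by a `{∧₂, ∨₂}`-circuit no larger than `C`, or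
constant.

DETERMINATION (`wireOf_vals_eq_of_freeze`): if two inputs `x, y` give the same value to every
member of the frozen family of `C`, then `C x = C y`. Indeed let `c_x` be the ACTUAL values of the
NOT gates in the run on `x`; by induction over the NOT gates in program order the run on `y` has
the same NOT values (the wire feeding the next NOT gate is a member of the family in the context
`c_x`, and the frozen run in context `c_x` coincides with the real run as long as the context is
right — `vals_freeze_eq`), and then both outputs are the output member in context `c_x`.

So pure fibres for the `m` negation-limited circuits would give pure fibres for the
`m' = m · 2^β · (β+1)` monotone members; since `m · v² ≤ t` and `v > 2^β (β+1)`, `m' < t`, and the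
landed monotone theorem `orIncompressibility_noMonotoneCompressionClique_proof`
(stmt-PneNP-13975: block saturation + Razborov / Alon–Boppana) supplies two inputs with equal
member values — hence equal circuit outputs — and different block-OR of `CLIQUE(v, ⌊√v⌋)`.

References: A. A. Markov, *On the inversion complexity of a system of functions*, J. ACM 5
(1958); M. J. Fischer, *The complexity of negation-limited networks* (1975); S. Jukna, *Boolean
Function Complexity* (2012), §10.5 (freezing NOT gates); L. Fortnow, R. Santhanam, JCSS 77 (2011)
(the OR-compression budget).
-/

set_option linter.dupNamespace false -- `Summit.PneNP.PneNP.…`: summit = sub-problem name (D-0017 single-conjunct layout)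

namespace Summit.PneNP.PneNP.Theorems

open Finset Filter
open Literature.Computability.Complexity GateList

/-! ### The theorem -/

/-- **Negation-limited OR-incompressibility of CLIQUE tuples** (route ORIncompressibility,
support item stmt-PneNP-13976 `NoNegLimitedCompressionClique`): for all `β, k`, for all large
`v`, all `m·v² ≤ t ≤ v^k` with `t > 0` and all families of `m` De Morgan circuits on `t` blocks of
edge variables `KEdge v` with `≤ β` NOT gates and `≤ (t v)^k` gates each, two inputs have the same
`m` output bits but different values of `⋁_i CLIQUE(v, ⌊√v⌋)(block i)`. Proof: the frozen family
(`m · 2^β · (β+1) < t` monotone members, each no larger than its circuit) determines the outputs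
(`wireOf_vals_eq_of_freeze`), and the monotone theorem
`orIncompressibility_noMonotoneCompressionClique_proof` applies to it (module docstring).
[cite: Jukna2012, §10.5] [cite: FortnowSanthanam2011, §1] -/
theorem orIncompressibility_noNegLimitedCompressionClique_proof :
    Summit.PneNP.PneNP.Theses.ORIncompressibility.NoNegLimitedCompressionClique := by
  unfold Summit.PneNP.PneNP.Theses.ORIncompressibility.NoNegLimitedCompressionClique
  intro β k
  classical
  -- the monotone theorem as a black box
  have hmon := orIncompressibility_noMonotoneCompressionClique_proof
  unfold Summit.PneNP.PneNP.Theses.ORIncompressibility.NoMonotoneCompressionClique at hmon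
  obtain ⟨v₁, hv₁⟩ := hmon k
  refine ⟨max v₁ (2 ^ β * (β + 1) + 1), fun v hv t m hmt ht htv C hC => ?_⟩
  have hvv₁ : v₁ ≤ v := le_trans (le_max_left _ _) hv
  have hvβ : 2 ^ β * (β + 1) < v :=
    lt_of_lt_of_le (Nat.lt_succ_self _) (le_trans (le_max_right _ _) hv)
  have hv2 : 2 ≤ v := by
    have h1 : 1 ≤ 2 ^ β := Nat.one_le_two_pow
    have h2 : 2 ^ β ≤ 2 ^ β * (β + 1) := Nat.le_mul_of_pos_right _ (Nat.succ_pos β)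
    omega
  -- a default input coordinate (for the constant members)
  have p₀ : Fin t × KEdge v := (⟨0, ht⟩, ⟨s((⟨0, by omega⟩ : Fin v), ⟨1, by omega⟩), by
    rw [SimpleGraph.mem_edgeSet, SimpleGraph.top_adj]
    simp [Fin.ext_iff]⟩)
  -- rank contexts, frozen programs, taps and the member functions
  set ctx : Fin m → (Fin β → Bool) → ℕ → Bool := fun j c n =>
    if h : negs ((C j).gates.take n) < β then c ⟨_, h⟩ else false with hctx_def
  set FZ : Fin m → (Fin β → Bool) → List (Gate (Fin t × KEdge v)) := fun j c =>
    (C j).gates.mapIdx fun n g => if negWeight g.fn = 1 then constGate _ (ctx j c n) else g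
    with hFZ_def
  set tap : Fin m → Fin (β + 1) → (Fin t × KEdge v) ⊕ ℕ := fun j ℓ =>
    if h : ∃ w n, ∃ hn : n < (C j).gates.length, (C j).gates[n] = notGate w ∧
        negs ((C j).gates.take n) = (ℓ : ℕ) then h.choose else (C j).output with htap_def
  set Fn : Fin m × (Fin β → Bool) × Fin (β + 1) → (Fin t × KEdge v → Bool) → Bool :=
    fun i z => wireOf z (vals (FZ i.1 i.2.1) z) (tap i.1 i.2.2) with hFn_def
  have hwfF : ∀ j c, WF (FZ j c) := fun j c => wf_freeze _ (wf_gates (C j))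
  have hBF : ∀ j c, ∀ g ∈ FZ j c, g.fn ∈ monotoneBasis01 := fun j c => fn_mem_freeze _ (hC j).1
  have hlenF : ∀ j c, (FZ j c).length = (C j).gates.length := fun j c => length_freeze _ _
  have htapOK : ∀ j ℓ, OutOK (C j).gates.length (tap j ℓ) := by
    intro j ℓ
    simp only [htap_def]
    split_ifs with h
    · obtain ⟨n, hn, hw, -⟩ := h.choose_spec
      exact fun m' hm' => (outOK_of_notGate (wf_gates (C j)) hn hw m' hm').trans hn
    · exact (C j).wf_output
  -- every member is constant or computed by a `{∧₂, ∨₂}`-circuit no larger than its circuit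
  have hmem : ∀ i : Fin m × (Fin β → Bool) × Fin (β + 1), (∃ b, ∀ z, Fn i z = b) ∨
      ∃ Mc : Circuit (Fin t × KEdge v), Mc.IsOver monotoneBasis ∧ Mc.size ≤ (t * v) ^ k ∧
        ∀ z, Mc.eval z = Fn i z := by
    rintro ⟨j, c, ℓ⟩
    rcases const_or_exists_monotone_circuit (FZ j c) (tap j ℓ) (hwfF j c) (hBF j c)
        (by rw [hlenF]; exact htapOK j ℓ) with h | ⟨Mc, hMcB, hMcsize, hMcev⟩
    · exact Or.inl h
    · refine Or.inr ⟨Mc, hMcB, ?_, hMcev⟩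
      rw [hlenF] at hMcsize
      exact hMcsize.trans (hC j).2.2
  -- the member circuits
  set D : Fin m × (Fin β → Bool) × Fin (β + 1) → Circuit (Fin t × KEdge v) := fun i =>
    if h : ∃ Mc : Circuit (Fin t × KEdge v), Mc.IsOver monotoneBasis ∧ Mc.size ≤ (t * v) ^ k ∧
        ∀ z, Mc.eval z = Fn i z then h.choose else Circuit.input p₀ with hD_def
  have hD : ∀ i, (D i).IsOver monotoneBasis ∧ (D i).size ≤ (t * v) ^ k := by
    intro i
    simp only [hD_def]
    split_ifs with h
    · exact ⟨h.choose_spec.1, h.choose_spec.2.1⟩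
    · exact ⟨fun g hg => by simp [Circuit.input] at hg, by simp⟩
  have hDdet : ∀ i z z', (D i).eval z = (D i).eval z' → Fn i z = Fn i z' := by
    intro i z z' h
    by_cases hex : ∃ Mc : Circuit (Fin t × KEdge v), Mc.IsOver monotoneBasis ∧
        Mc.size ≤ (t * v) ^ k ∧ ∀ z, Mc.eval z = Fn i z
    · have hDi : D i = hex.choose := by simp only [hD_def]; rw [dif_pos hex]
      rw [hDi] at h
      rw [← hex.choose_spec.2.2 z, ← hex.choose_spec.2.2 z', h]
    · rcases hmem i with ⟨b, hb⟩ | hMc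
      · rw [hb z, hb z']
      · exact absurd hMc hex
  -- the family is small: `m · 2^β · (β+1) < t`
  have hcard : Fintype.card (Fin m × (Fin β → Bool) × Fin (β + 1)) = m * (2 ^ β * (β + 1)) := by
    simp only [Fintype.card_prod, Fintype.card_fun, Fintype.card_bool, Fintype.card_fin]
  have hm' : Fintype.card (Fin m × (Fin β → Bool) × Fin (β + 1)) < t := by
    rw [hcard]
    rcases Nat.eq_zero_or_pos m with hm0 | hmpos
    · rw [hm0, zero_mul]
      exact ht
    · have h1 : 2 ^ β * (β + 1) < v ^ 2 := hvβ.trans_le (by nlinarith)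
      calc m * (2 ^ β * (β + 1)) < m * v ^ 2 := Nat.mul_lt_mul_of_pos_left h1 hmpos
        _ ≤ t := hmt
  -- the monotone theorem, applied to the family
  set e := (Fintype.equivFin (Fin m × (Fin β → Bool) × Fin (β + 1))).symm with he
  obtain ⟨x, y, hxy, hOR⟩ := hv₁ v hvv₁ t _ hm' htv (fun i' => D (e i')) (fun i' => hD (e i'))
  refine ⟨x, y, fun j => ?_, hOR⟩
  have hxyI : ∀ i, (D i).eval x = (D i).eval y := by
    intro i
    have h := hxy (e.symm i)
    rwa [Equiv.apply_symm_apply] at h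
  -- determination of output `j` by the members `(j, cx, ·)`, `cx` the actual NOT values on `x`
  rw [circuit_eval, circuit_eval]
  set cx : Fin β → Bool := fun ℓ =>
    if h : ∃ n, ∃ hn : n < (C j).gates.length, negWeight ((C j).gates[n]).fn = 1 ∧
        negs ((C j).gates.take n) = (ℓ : ℕ) then (vals (C j).gates x).getD h.choose false
    else false with hcx_def
  have hβ : negs (C j).gates ≤ β := by rw [← circuit_negationCount]; exact (hC j).2.1
  have hctx : ∀ n (hn : n < (C j).gates.length), negWeight ((C j).gates[n]).fn = 1 →
      ctx j cx n = (vals (C j).gates x).getD n false := by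
    intro n hn hneg
    have hr : negs ((C j).gates.take n) < β :=
      (negs_take_lt_of_notGate _ hn hneg).trans_le hβ
    have hex : ∃ n', ∃ hn' : n' < (C j).gates.length, negWeight ((C j).gates[n']).fn = 1 ∧
        negs ((C j).gates.take n') = ((⟨negs ((C j).gates.take n), hr⟩ : Fin β) : ℕ) :=
      ⟨n, hn, hneg, rfl⟩
    have h1 : ctx j cx n = (vals (C j).gates x).getD hex.choose false := by
      simp only [hctx_def, hcx_def]
      rw [dif_pos hr, dif_pos hex]
    obtain ⟨hn', hneg', hrk⟩ := hex.choose_spec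
    have h3 : hex.choose = n := eq_of_negs_take_eq _ hn' hn hneg' hneg hrk
    rw [h1, h3]
  have hFZ : FZ j cx = (C j).gates.mapIdx fun n g => if negWeight g.fn = 1 then
      constGate _ ((vals (C j).gates x).getD n false) else g := by
    simp only [hFZ_def]
    exact freeze_congr hctx
  refine wireOf_vals_eq_of_freeze (wf_gates (C j)) (C j).output x y (fun n hn w hw => ?_) ?_
  · -- the member tapping this NOT gate
    have hneg : negWeight ((C j).gates[n]).fn = 1 := by rw [hw]; simp
    have hr : negs ((C j).gates.take n) < β := (negs_take_lt_of_notGate _ hn hneg).trans_le hβ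
    set ℓ₀ : Fin (β + 1) := ⟨negs ((C j).gates.take n), by omega⟩ with hℓ₀
    have hex : ∃ w' n', ∃ hn' : n' < (C j).gates.length, (C j).gates[n'] = notGate w' ∧
        negs ((C j).gates.take n') = (ℓ₀ : ℕ) := ⟨w, n, hn, hw, rfl⟩
    have htap : tap j ℓ₀ = w := by
      simp only [htap_def]
      rw [dif_pos hex]
      obtain ⟨n', hn', hw', hrk⟩ := hex.choose_spec
      have hneg' : negWeight ((C j).gates[n']).fn = 1 := by rw [hw']; simp
      have hnn : n' = n := eq_of_negs_take_eq _ hn' hn hneg' hneg hrk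
      subst hnn
      exact notGate_injective (hw'.symm.trans hw)
    have key := hDdet (j, cx, ℓ₀) x y (hxyI _)
    simp only [hFn_def] at key
    rw [htap, hFZ] at key
    exact key
  · -- the output member
    have htap : tap j (Fin.last β) = (C j).output := by
      simp only [htap_def]
      rw [dif_neg]
      rintro ⟨w', n', hn', hw', hrk⟩
      have hneg' : negWeight ((C j).gates[n']).fn = 1 := by rw [hw']; simp
      have h1 := negs_take_lt_of_notGate _ hn' hneg'
      simp only [Fin.val_last] at hrk
      omega
    have key := hDdet (j, cx, Fin.last β) x y (hxyI _)
    simp only [hFn_def] at key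
    rw [htap, hFZ] at key
    exact key

end Summit.PneNP.PneNP.Theorems
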